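import Summits.AtomisticToContinuum.Crystallization.Theorems.OverbindingBudgetAffineFarFieldCollarSites
import Summits.AtomisticToContinuum.Crystallization.Theorems.OverbindingBudgetAffineFarFieldCollarAssembly

/-!
# Interface pieces of the Barlow reference tessellation: the facet dictionary

Support file for route `OverbindingBudget`, crux `RobustDefectLimitWindows` (sub-part SW♭(30)·27V, the Voronoi-cell
quadrature of the far field; «27VI-SOUND (a2)»).  The interface row `interfaceRow_window` («CollarWindow») charges,
per listed pair `k = (u,u')` of reference sites, the volume of the tube `cthickening (W k) (cell u ∩ cell u')` against a
book `V k` (hypothesis `hV`).  This file PROVES the books for the two kinds of listed pairs of the placed Barlow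
stacking `placedSite s ν q R` («CollarSites»):

* `√2`-contacts (`barlowSiteForm = 24`): the two cells meet in the MIDPOINT only (Cauchy–Schwarz against the
  circumradius `ν/√2`), so the tube is a ball of radius `W`: book `(4/3)πW³` (`contactPiece_volume_le`, via «CollarAssembly»);
* nearest neighbours (`barlowSiteForm = 12`): the piece is the common FACET; through the placement isometry of
  «CellLattice» (`voronoiCell_placed_barlowStacking`: cell = placed ideal cell AND kissing shell = placed kissing
  pattern, by the SAME isometry) the neighbour `u'` is a pattern vector `w ∈ fccInt / hcpInt`, the piece lies in the
  cap of the ideal cell at `w` with `ε = 0`, and «CellFacetsRows» (`rdCell_cap_subset_prism_rows`,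
  `trdCell_cap_subset_prism_rows`) puts the piece in a placed flat box with the determinant and dual rows of the
  rhombus facet, or of the trapezoid facet (`bondPiece_subset_frame`); the volume books by dual rows follow in
  «CollarTubes» (`bondPiece_volume_le`).  Which case applies is DECIDABLE on the indices: an `h`-site `u`
  (`s (u.1-1) ≠ s u.1`) and a nearest neighbour `u'` in ANOTHER layer always span a rhombus — the in-layer pattern
  vectors are exactly those whose opposite is again a pattern vector (`decide`), and the reflected neighbour
  `2·site u − site u'` of a cross-layer neighbour of an `h`-site is never a site (`reflected_not_site_of_ne`, label
  arithmetic `haggLabel_succ`).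

References: Hales, Dense Sphere Packings (2012) §1.3 [HalesDSP2012]; Conway–Sloane, SPLAG Ch. 4 §6.3
[ConwaySloane1999]; the tree files cited.
-/

noncomputable section

namespace Summit.AtomisticToContinuum.Crystallization.Theorems.OverbindingBudgetAffineFarFieldCollarFacets

open Set Metric MeasureTheory Real
open scoped Pointwise
open Literature.MathematicalPhysics.StatisticalMechanics
open Literature.Barriers.AtomisticToContinuum (voronoiCell)
open Literature.Geometry.DiscreteGeometry (intVec intVec_apply fccInt hcpInt fccKissingPattern hcpKissingPattern
  scaledPattern kissingShell norm_eq_one_of_mem_fccKissingPattern norm_eq_one_of_mem_hcpKissingPattern layerSpacing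
  layerSpacing_pos layerSpacing_sq layerSpacing_sq')
open Summit.AtomisticToContinuum.Crystallization.Theorems.OverbindingBudgetAffineFarFieldCellRD (rdCell)
open Summit.AtomisticToContinuum.Crystallization.Theorems.OverbindingBudgetAffineFarFieldCellTRD (trdCell)
open Summit.AtomisticToContinuum.Crystallization.Theorems.OverbindingBudgetAffineFarFieldCellLedgerIdeal (idealCell)
open Summit.AtomisticToContinuum.Crystallization.Theorems.OverbindingBudgetAffineFarFieldCellLattice
open Summit.AtomisticToContinuum.Crystallization.Theorems.OverbindingBudgetAffineFarFieldCellFacets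
open Summit.AtomisticToContinuum.Crystallization.Theorems.OverbindingBudgetAffineFarFieldCellFacetsRows
open Summit.AtomisticToContinuum.Crystallization.Theorems.OverbindingBudgetAffineFarFieldCollarSites
open Summit.AtomisticToContinuum.Crystallization.Theorems.OverbindingBudgetAffineFarFieldCollarAssembly (pointPiece_volume_le)

local notation "E3" => EuclideanSpace ℝ (Fin 3)
local notation "Idx" => ℤ × ℤ × ℤ

variable {s : ℤ → ℤ} {ν : ℝ} {q : E3} {R : E3 ≃ₗᵢ[ℝ] E3}

/-! ## §1 `√2`-contacts: the piece is the midpoint -/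

/-- support: a point of the cell of `u'` is at least as close to `site u'` as to `site u`; in inner-product form
`‖d‖²/2 ≤ ⟨z − site u, d⟩`, `d = site u' − site u`. [this file] -/
theorem half_norm_sq_le_inner_of_mem_voronoiCell (u u' : Idx) {z : E3}
    (hz : z ∈ voronoiCell (range (placedSite s ν q R)) (placedSite s ν q R u')) :
    ‖placedSite s ν q R u' - placedSite s ν q R u‖ ^ 2 / 2 ≤
      inner ℝ (z - placedSite s ν q R u) (placedSite s ν q R u' - placedSite s ν q R u) := by
  have h := hz (placedSite s ν q R u) (mem_range_self u)
  rw [dist_eq_norm, dist_eq_norm] at h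
  have h2 := pow_le_pow_left₀ (norm_nonneg _) h 2
  have e : z - placedSite s ν q R u' = (z - placedSite s ν q R u) - (placedSite s ν q R u' - placedSite s ν q R u) := by
    abel
  rw [e, norm_sub_sq_real] at h2
  linarith

/-- ★ support: POINT PIECES — the cells of two sites at distance `√2·ν` (`barlowSiteForm = 24`) meet in the midpoint
only: a common point is within the circumradius `ν/√2` of `site u` and on the far side of the bisector, and
`⟨z − u, d⟩ ≤ ‖z − u‖·‖d‖ ≤ (ν/√2)(√2 ν) = ‖d‖²/2` forces `z − site u = d/2`. [this file] -/
theorem contactPiece_subset_midpoint (hs : IsHaggSeq s) (hν : 0 < ν) {u u' : Idx} (h24 : barlowSiteForm s u u' = 24) :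
    voronoiCell (range (placedSite s ν q R)) (placedSite s ν q R u) ∩
        voronoiCell (range (placedSite s ν q R)) (placedSite s ν q R u') ⊆
      {midpoint ℝ (placedSite s ν q R u) (placedSite s ν q R u')} := by
  rintro z ⟨hzu, hzu'⟩
  rw [mem_singleton_iff]
  set a := placedSite s ν q R u
  set d := placedSite s ν q R u' - placedSite s ν q R u
  have hr := dist_le_of_mem_voronoiCell_placedSite (q := q) (R := R) hs hν u z hzu
  rw [dist_eq_norm] at hr
  have hi := half_norm_sq_le_inner_of_mem_voronoiCell u u' hzu'
  have hd : ‖d‖ ^ 2 = 2 * ν ^ 2 := by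
    have h12 := twelve_mul_dist_placedSite_sq (s := s) (q := q) (R := R) hν.le u u'
    rw [h24, dist_comm, dist_eq_norm] at h12
    push_cast at h12
    linarith
  have hs2 : (0 : ℝ) < Real.sqrt 2 := Real.sqrt_pos.2 two_pos
  have hr2 : ‖z - a‖ ^ 2 ≤ ν ^ 2 / 2 := by
    have h1 := pow_le_pow_left₀ (norm_nonneg _) hr 2
    rw [div_pow, Real.sq_sqrt two_pos.le] at h1
    exact h1
  have hkey : ‖(z - a) - (1 / 2 : ℝ) • d‖ ^ 2 ≤ 0 := by
    rw [norm_sub_sq_real, inner_smul_right, norm_smul, mul_pow]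
    norm_num
    nlinarith
  have h0 : (z - a) - (1 / 2 : ℝ) • d = 0 := by
    have := le_antisymm hkey (sq_nonneg _)
    rwa [sq_eq_zero_iff, norm_eq_zero] at this
  rw [sub_eq_zero] at h0
  have hz : z = a + (1 / 2 : ℝ) • d := by rw [← h0]; abel
  rw [hz, midpoint_eq_smul_add, invOf_eq_inv]
  simp only [a, d, one_div, smul_add, smul_sub]
  module

/-- ★ support: TUBE BOOK of a `√2`-contact: `volume (cthickening W (cell u ∩ cell u')) ≤ (4/3)·π·W³`.
[this file + «CollarAssembly» pointPiece_volume_le] -/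
theorem contactPiece_volume_le (hs : IsHaggSeq s) (hν : 0 < ν) {u u' : Idx} (h24 : barlowSiteForm s u u' = 24)
    {W : ℝ} (hW : 0 ≤ W) :
    (volume (cthickening W (voronoiCell (range (placedSite s ν q R)) (placedSite s ν q R u) ∩
        voronoiCell (range (placedSite s ν q R)) (placedSite s ν q R u')))).toReal ≤ 4 / 3 * Real.pi * W ^ 3 :=
  pointPiece_volume_le (contactPiece_subset_midpoint hs hν h24) hW

/-! ## §2 Cross-layer neighbours of an `h`-site are not reflected -/

/-- support: nearest neighbours in different layers are in ADJACENT layers (`8(k−k')² ≤ 12`). [this file] -/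
theorem layer_adjacent_of_form_eq_twelve {u u' : Idx} (h12 : barlowSiteForm s u u' = 12) (hne : u.1 ≠ u'.1) :
    u'.1 = u.1 + 1 ∨ u'.1 = u.1 - 1 := by
  unfold barlowSiteForm at h12
  have h1 : 8 * (u.1 - u'.1) ^ 2 ≤ 12 := by
    nlinarith [sq_nonneg (3 * (u.2.2 - u'.2.2) + (haggLabel s u.1 - haggLabel s u'.1)),
      sq_nonneg (2 * (u.2.1 - u'.2.1) + (u.2.2 - u'.2.2) + (haggLabel s u.1 - haggLabel s u'.1))]
  have h3 : -1 ≤ u.1 - u'.1 ∧ u.1 - u'.1 ≤ 1 := by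
    constructor <;> nlinarith [sq_nonneg (u.1 - u'.1 + 1), sq_nonneg (u.1 - u'.1 - 1)]
  omega

/-- ★ support: REFLECTED CROSS-LAYER NEIGHBOURS OF AN `h`-SITE ARE NOT SITES — if `s (k-1) ≠ s k` (layer `k` is an
`h`-layer) and `u' = (k±1, i', j')` is a nearest neighbour of `u = (k, i, j)`, then `2·pos u − pos u'` is not a point
of the stacking: it would lie in layer `k∓1` with `3 ∣ L(k-1) + L(k+1) − 2L(k) = s k − s (k-1) = ±2`.
[this file; HalesDSP2012 §1.3 (`ABA`)] -/
theorem reflected_not_site_of_ne (hs : IsHaggSeq s) {u u' : Idx} (hh : s (u.1 - 1) ≠ s u.1)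
    (h12 : barlowSiteForm s u u' = 12) (hne : u.1 ≠ u'.1) (u'' : Idx) :
    barlowPos 2 layerSpacing s u''.1 u''.2.1 u''.2.2 ≠
      (2 : ℝ) • barlowPos 2 layerSpacing s u.1 u.2.1 u.2.2 - barlowPos 2 layerSpacing s u'.1 u'.2.1 u'.2.2 := by
  intro hE
  have e2 := congrArg (fun x : E3 => x 2) hE
  have e1 := congrArg (fun x : E3 => x 1) hE
  simp only [PiLp.sub_apply, PiLp.smul_apply, smul_eq_mul, barlowPos_apply_two, barlowPos_apply_one] at e1 e2
  have hL : 0 < layerSpacing := layerSpacing_pos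
  have hk : (u''.1 : ℝ) = 2 * u.1 - u'.1 := by
    have := mul_right_cancel₀ hL.ne' (show (u''.1 : ℝ) * layerSpacing = (2 * u.1 - u'.1) * layerSpacing by linarith)
    exact this
  have hk' : u''.1 = 2 * u.1 - u'.1 := by exact_mod_cast hk
  have hs3 : (0 : ℝ) < Real.sqrt 3 := Real.sqrt_pos.2 (by norm_num)
  have hj : (3 * u''.2.2 + haggLabel s u''.1 : ℝ) = 2 * (3 * u.2.2 + haggLabel s u.1) - (3 * u'.2.2 + haggLabel s u'.1) := by
    have h6 : (2 : ℝ) * Real.sqrt 3 / 2 ≠ 0 := by positivity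
    have := e1
    field_simp at this
    nlinarith [this, hs3]
  have hj' : 3 * u''.2.2 + haggLabel s u''.1 = 2 * (3 * u.2.2 + haggLabel s u.1) - (3 * u'.2.2 + haggLabel s u'.1) := by
    exact_mod_cast hj
  have hsucc := haggLabel_succ s u.1
  have hpred : haggLabel s u.1 = haggLabel s (u.1 - 1) + s (u.1 - 1) := by
    have := haggLabel_succ s (u.1 - 1); rwa [sub_add_cancel] at this
  have key : s (u.1 - 1) - s u.1 = 3 * (u''.2.2 - 2 * u.2.2 + u'.2.2) := by
    rcases layer_adjacent_of_form_eq_twelve h12 hne with hk1 | hk1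
    · rw [hk1] at hk' hj'
      rw [show 2 * u.1 - (u.1 + 1) = u.1 - 1 by ring] at hk'
      rw [hk', hsucc, hpred] at hj'
      linarith
    · rw [hk1] at hk' hj'
      rw [show 2 * u.1 - (u.1 - 1) = u.1 + 1 by ring] at hk'
      rw [hk', hsucc, hpred] at hj'
      linarith
  rcases hs u.1 with ha | ha <;> rcases hs (u.1 - 1) with hb | hb <;> omega

/-- support: the in-layer vectors of the hcp integer pattern are exactly those whose opposite is again a pattern
vector (the hexagon is centrally symmetric, the two caps are swapped with a twist). [KissingPatterns, by `decide`] -/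
theorem neg_mem_hcpInt_iff : ∀ w ∈ hcpInt, (-w ∈ hcpInt ↔ w 0 + w 1 + w 2 = 0) := by decide

/-- support: the fcc integer pattern is centrally symmetric. [KissingPatterns, by `decide`] -/
theorem neg_mem_fccInt : ∀ w ∈ fccInt, -w ∈ fccInt := by decide

/-! ## §3 Nearest neighbours: the piece is a placed facet of the ideal cell -/

/-- support: THE PLACEMENT of «CellLattice» in `placedSite` form, keeping BOTH conclusions: one isometry `A` carries
the kissing pattern of the letter of `u` onto the kissing shell of `u` AND the ideal cell onto the Voronoi cell.
[«CellLattice» voronoiCell_placed_barlowStacking] -/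
theorem exists_barlowPlacement (hs : IsHaggSeq s) (hν : 0 < ν) (u : Idx) :
    ∃ A : E3 ≃ₗᵢ[ℝ] E3,
      kissingShell (barlowStacking 2 layerSpacing s) (barlowPos 2 layerSpacing s u.1 u.2.1 u.2.2) =
          (fun p : E3 => (2 : ℝ) • A p) ''
            ((bif decide (s (u.1 - 1) = s u.1) then fccKissingPattern else hcpKissingPattern : Finset E3) : Set E3) ∧
        voronoiCell (range (placedSite s ν q R)) (placedSite s ν q R u) =
          (fun y => placedSite s ν q R u + R (A y)) '' idealCell (decide (s (u.1 - 1) = s u.1)) ν := by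
  obtain ⟨A, hK, hV⟩ := voronoiCell_placed_barlowStacking hs u.1 u.2.1 u.2.2 hν q R
  refine ⟨A, hK, ?_⟩
  rw [range_placedSite, placedSite_apply, hV]

/-- support: a nearest neighbour (`barlowSiteForm = 12`) is a kissing-shell vector, hence `2·A p` for a pattern
vector `p` of the letter of `u`. [this file] -/
theorem exists_pattern_of_form_eq_twelve {u u' : Idx} (h12 : barlowSiteForm s u u' = 12)
    {A : E3 ≃ₗᵢ[ℝ] E3} {P : Set E3}
    (hA : kissingShell (barlowStacking 2 layerSpacing s) (barlowPos 2 layerSpacing s u.1 u.2.1 u.2.2) =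
      (fun p : E3 => (2 : ℝ) • A p) '' P) :
    ∃ p ∈ P, barlowPos 2 layerSpacing s u'.1 u'.2.1 u'.2.2 - barlowPos 2 layerSpacing s u.1 u.2.1 u.2.2 =
      (2 : ℝ) • A p := by
  have hd : dist (barlowPos 2 layerSpacing s u'.1 u'.2.1 u'.2.2) (barlowPos 2 layerSpacing s u.1 u.2.1 u.2.2) = 2 := by
    rw [dist_comm]
    exact (dist_barlowPos_eq_iff_form two_pos layerSpacing_sq' s u.1 u.2.1 u.2.2 u'.1 u'.2.1 u'.2.2).2 h12
  have hmem : barlowPos 2 layerSpacing s u'.1 u'.2.1 u'.2.2 - barlowPos 2 layerSpacing s u.1 u.2.1 u.2.2 ∈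
      kissingShell (barlowStacking 2 layerSpacing s) (barlowPos 2 layerSpacing s u.1 u.2.1 u.2.2) := by
    refine ⟨?_, by rw [← dist_eq_norm, hd]⟩
    rw [add_sub_cancel, mem_barlowStacking_iff]
    exact ⟨u'.1, u'.2.1, u'.2.2, rfl⟩
  rw [hA] at hmem
  obtain ⟨p, hp, e⟩ := hmem
  exact ⟨p, hp, e.symm⟩

/-- support: THE CAP CONDITION — a point `site u + R (A y)` of the cell of a nearest neighbour `u'` with
`pos u' − pos u = 2·A p`, `‖p‖ = 1`, satisfies `ν²/2 ≤ ⟨y, ν·p⟩` (the far side of the bisector, pulled back by the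
placement). [this file] -/
theorem cap_of_mem_voronoiCell (hν : 0 < ν) {u u' : Idx} {A : E3 ≃ₗᵢ[ℝ] E3} {p y : E3} (hp : ‖p‖ = 1)
    (he : barlowPos 2 layerSpacing s u'.1 u'.2.1 u'.2.2 - barlowPos 2 layerSpacing s u.1 u.2.1 u.2.2 = (2 : ℝ) • A p)
    (hz : placedSite s ν q R u + R (A y) ∈ voronoiCell (range (placedSite s ν q R)) (placedSite s ν q R u')) :
    ν ^ 2 / 2 ≤ inner ℝ y (ν • p) := by
  have h := half_norm_sq_le_inner_of_mem_voronoiCell u u' hz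
  have hd : placedSite s ν q R u' - placedSite s ν q R u = ν • R (A p) := by
    rw [placedSite_apply, placedSite_apply, add_sub_add_left_eq_sub, ← smul_sub, ← map_sub, he, map_smul, smul_smul]
    congr 1
    ring
  rw [hd, add_sub_cancel_left, norm_smul, R.norm_map, A.norm_map, hp, mul_one, Real.norm_of_nonneg hν.le,
    inner_smul_right, R.inner_map_map, A.inner_map_map] at h
  rwa [inner_smul_right]

/-- support: TRANSPORT of an affine box frame through the placement `y ↦ a + G y`. [this file] -/
theorem subset_image_comp {K C B S : Set E3} (G : E3 ≃ₗᵢ[ℝ] E3) (a p₀ : E3) (T : E3 →L[ℝ] E3)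
    (hKC : K ∩ C ⊆ (fun x => p₀ + T x) '' B) (hS : S ⊆ (fun y => a + G y) '' (K ∩ C)) :
    S ⊆ (fun x => (a + G p₀) + (G.toLinearIsometry.toContinuousLinearMap.comp T) x) '' B := by
  intro z hz
  obtain ⟨y, hy, rfl⟩ := hS hz
  obtain ⟨x, hx, rfl⟩ := hKC hy
  refine ⟨x, hx, ?_⟩
  simp only [ContinuousLinearMap.comp_apply, isometry_clm_apply, map_add]
  abel

/-- ★ support: THE FACET DICTIONARY — for a nearest-neighbour pair `(u,u')` the piece `cell u ∩ cell u'` lies in a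
placed flat box (an affine image of `[0,1]²×{0}`) whose frame has the determinant and dual rows of the rhombus facet
(`4h³`; `3/(8h²), 3/(8h²), 1/(2h²)`, `h = ν/(2√2)`) — or, ONLY when `u` is an `h`-site and `u'` lies in the same
layer, possibly those of the trapezoid facet (`16h³/3`; `27/(128h²), 3/(8h²), 1/(2h²)`).
[this file + «CellLattice» + «CellFacetsRows» + KissingPatterns] -/
theorem bondPiece_subset_frame (hs : IsHaggSeq s) (hν : 0 < ν) {u u' : Idx} (h12 : barlowSiteForm s u u' = 12) :
    ∃ (trap : Bool) (p : E3) (T : E3 →L[ℝ] E3) (Rr : Fin 3 → E3),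
      (trap = true → s (u.1 - 1) ≠ s u.1 ∧ u.1 = u'.1) ∧
      |T.det| = (if trap = true then 16 / 3 * (ν / (2 * Real.sqrt 2)) ^ 3 else 4 * (ν / (2 * Real.sqrt 2)) ^ 3) ∧
      Function.Surjective T ∧ (∀ x i, inner ℝ (Rr i) (T x) = x i) ∧
      (∀ i, ‖Rr i‖ ^ 2 = (if trap = true then
          ![27 / (128 * (ν / (2 * Real.sqrt 2)) ^ 2), 3 / (8 * (ν / (2 * Real.sqrt 2)) ^ 2), 1 / (2 * (ν / (2 * Real.sqrt 2)) ^ 2)]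
        else ![3 / (8 * (ν / (2 * Real.sqrt 2)) ^ 2), 3 / (8 * (ν / (2 * Real.sqrt 2)) ^ 2),
          1 / (2 * (ν / (2 * Real.sqrt 2)) ^ 2)]) i) ∧
      voronoiCell (range (placedSite s ν q R)) (placedSite s ν q R u) ∩
          voronoiCell (range (placedSite s ν q R)) (placedSite s ν q R u') ⊆
        (fun x => p + T x) '' {x : E3 | ∀ i, ![-((0 : ℝ) / 2), -((0 : ℝ) / 2), -(0 : ℝ)] i ≤ x i ∧
          x i ≤ ![1 + (0 : ℝ) / 2, 1 + (0 : ℝ) / 2, 0] i} := by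
  set h : ℝ := ν / (2 * Real.sqrt 2) with hdef
  have hs2 : (0 : ℝ) < Real.sqrt 2 := Real.sqrt_pos.2 two_pos
  have hh : 0 < h := by positivity
  have hh2 : h ^ 2 = ν ^ 2 / 8 := by
    rw [hdef, div_pow, mul_pow, Real.sq_sqrt two_pos.le]; ring
  obtain ⟨A, hK, hV⟩ := exists_barlowPlacement (q := q) (R := R) hs hν u
  set G : E3 ≃ₗᵢ[ℝ] E3 := A.trans R with hGdef
  have hG : ∀ v, ‖G.toLinearIsometry.toContinuousLinearMap v‖ = ‖v‖ := fun v => G.norm_map v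
  have hGsurj : ∀ {T : E3 →L[ℝ] E3}, Function.Surjective T →
      Function.Surjective (G.toLinearIsometry.toContinuousLinearMap.comp T) := by
    intro T hT z
    obtain ⟨x, hx⟩ := hT (G.symm z)
    exact ⟨x, by simp [isometry_clm_apply, hx]⟩
  -- the piece, pulled back: `y ∈ idealCell ∩ cap`
  have hpull : ∀ {p : E3}, ‖p‖ = 1 →
      barlowPos 2 layerSpacing s u'.1 u'.2.1 u'.2.2 - barlowPos 2 layerSpacing s u.1 u.2.1 u.2.2 = (2 : ℝ) • A p →
      voronoiCell (range (placedSite s ν q R)) (placedSite s ν q R u) ∩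
          voronoiCell (range (placedSite s ν q R)) (placedSite s ν q R u') ⊆
        (fun y => placedSite s ν q R u + G y) ''
          (idealCell (decide (s (u.1 - 1) = s u.1)) ν ∩ {y | 4 * h ^ 2 * (1 - 0) ≤ inner ℝ y (ν • p)}) := by
    intro p hp he z ⟨hzu, hzu'⟩
    rw [hV] at hzu
    obtain ⟨y, hy, rfl⟩ := hzu
    refine ⟨y, ⟨hy, ?_⟩, rfl⟩
    rw [mem_setOf_eq, sub_zero, mul_one, hh2]
    have := cap_of_mem_voronoiCell (q := q) (R := R) hν hp he hzu'
    linarith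
  by_cases hb : s (u.1 - 1) = s u.1
  · -- `k`-site: the rhombic dodecahedron, every facet a rhombus
    rw [decide_eq_true hb] at hK hV hpull
    simp only [cond_true] at hK hV hpull
    obtain ⟨p, hp, he⟩ := exists_pattern_of_form_eq_twelve h12 hK
    have hp1 : ‖p‖ = 1 := norm_eq_one_of_mem_fccKissingPattern (Finset.mem_coe.1 hp)
    have hp' := Finset.mem_coe.1 hp
    simp only [fccKissingPattern, scaledPattern, Finset.mem_image] at hp'
    obtain ⟨w, hw, hwp⟩ := hp'
    simp only [Nat.cast_ofNat] at hwp
    have hνp : ν • p = (2 * h) • intVec w := by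
      rw [← hwp, smul_smul, hdef]; congr 1; field_simp
    obtain ⟨p₀, T, Rr, hdet, -, hsurj, hR, hρ, hsub⟩ := rdCell_cap_subset_prism_rows hh hw 0
    have hpiece : voronoiCell (range (placedSite s ν q R)) (placedSite s ν q R u) ∩
          voronoiCell (range (placedSite s ν q R)) (placedSite s ν q R u') ⊆
        (fun y => placedSite s ν q R u + G y) '' (rdCell h ∩ {y | 4 * h ^ 2 * (1 - 0) ≤ inner ℝ y ((2 * h) • intVec w)}) := by
      rw [← hνp]; exact hpull hp1 he
    have hsub' := subset_image_comp G (placedSite s ν q R u) p₀ T hsub hpiece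
    refine ⟨false, _, _, fun i => G (Rr i), by simp, ?_, hGsurj hsurj, rows_comp_isometry G hR, ?_, hsub'⟩
    · rw [abs_det_comp_of_norm_eq_left _ _ hG, hdet]; simp
    · intro i; rw [G.norm_map, hρ i]; simp
  · -- `h`-site: the trapezo-rhombic dodecahedron; in-layer neighbours ↔ centrally placed pattern vectors
    rw [decide_eq_false hb] at hK hV hpull
    simp only [cond_false] at hK hV hpull
    obtain ⟨p, hp, he⟩ := exists_pattern_of_form_eq_twelve h12 hK
    have hp1 : ‖p‖ = 1 := norm_eq_one_of_mem_hcpKissingPattern (Finset.mem_coe.1 hp)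
    have hp' := Finset.mem_coe.1 hp
    simp only [hcpKissingPattern, scaledPattern, Finset.mem_image] at hp'
    obtain ⟨w, hw, hwp⟩ := hp'
    simp only [Nat.cast_ofNat] at hwp
    have hνp : ν • p = (2 * h / 3) • intVec w := by
      rw [← hwp, smul_smul, hdef, Literature.Barriers.AtomisticToContinuum.sqrt_eighteen]; congr 1; field_simp
    obtain ⟨p₀, T, Rr, hdet, -, hsurj, hR, hρ, hsub⟩ :=
      trdCell_cap_subset_prism_rows (ε := 0) hh (by norm_num) hw
    have hpiece : voronoiCell (range (placedSite s ν q R)) (placedSite s ν q R u) ∩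
          voronoiCell (range (placedSite s ν q R)) (placedSite s ν q R u') ⊆
        (fun y => placedSite s ν q R u + G y) ''
          (trdCell h ∩ {y | 4 * h ^ 2 * (1 - 0) ≤ inner ℝ y ((2 * h / 3) • intVec w)}) := by
      rw [← hνp]; exact hpull hp1 he
    have hsub' := subset_image_comp G (placedSite s ν q R u) p₀ T hsub hpiece
    -- the facet class: in-layer pattern vector ⇒ same layer (else the reflected neighbour would be a site)
    have hclass : w 0 + w 1 + w 2 = 0 → u.1 = u'.1 := by
      intro hw0
      by_contra hne
      have hnw : -w ∈ hcpInt := (neg_mem_hcpInt_iff w hw).2 hw0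
      have hmem : -(barlowPos 2 layerSpacing s u'.1 u'.2.1 u'.2.2 - barlowPos 2 layerSpacing s u.1 u.2.1 u.2.2) ∈
          kissingShell (barlowStacking 2 layerSpacing s) (barlowPos 2 layerSpacing s u.1 u.2.1 u.2.2) := by
        rw [hK, he, ← smul_neg, ← map_neg]
        refine ⟨-p, ?_, rfl⟩
        rw [Finset.mem_coe]
        simp only [hcpKissingPattern, scaledPattern, Finset.mem_image]
        exact ⟨-w, hnw, by rw [Nat.cast_ofNat, ← hwp, ← smul_neg]; congr 1; ext i; simp [intVec_apply]⟩
      obtain ⟨hV', -⟩ := hmem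
      rw [mem_barlowStacking_iff] at hV'
      obtain ⟨k, i, j, hkij⟩ := hV'
      exact reflected_not_site_of_ne hs hb h12 hne (k, i, j)
        (show barlowPos 2 layerSpacing s k i j = _ by rw [← hkij]; module)
    refine ⟨decide (w 0 + w 1 + w 2 = 0), _, _, fun i => G (Rr i), ?_, ?_, hGsurj hsurj, rows_comp_isometry G hR, ?_,
      hsub'⟩
    · intro ht; exact ⟨hb, hclass (of_decide_eq_true ht)⟩
    · rw [abs_det_comp_of_norm_eq_left _ _ hG, hdet]
      by_cases hw0 : w 0 + w 1 + w 2 = 0 <;> simp [hw0]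
    · intro i; rw [G.norm_map, hρ i]
      by_cases hw0 : w 0 + w 1 + w 2 = 0 <;> simp [hw0]

end Summit.AtomisticToContinuum.Crystallization.Theorems.OverbindingBudgetAffineFarFieldCollarFacets
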